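import Literature.Probability.LatticeModels.OnsagerToeplitzProofs
import Literature.Analysis.Toeplitz.StrongSzegoGeometric
import HarnessLib

/-!
# The Montroll–Potts–Ward long-range order: discharge of `torusRowPairLimit_tendsto_onsagerYang_sq`

Topic `Probability/LatticeModels`, namespace `Literature.Probability.LatticeModels`. Fifth file of
the Benettin–Gallavotti–Jona-Lasinio–Stella route to `onsager_yang` (`OnsagerYang.lean`,
`OnsagerYangProofs.lean`, `OnsagerToeplitz.lean`, `OnsagerToeplitzProofs.lean`). `OnsagerToeplitz`
reduced the named fact `torusRowPairLimit_tendsto_onsagerYang_sq` (BGJS eq. (3.4), the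
Montroll–Potts–Ward long-range order `(σ_{(0,0)}σ_{(k,0)})_p(β) → m_O(β)²`, `β > β_c(2)`) to the
Toeplitz identity `torusRowPair_tendsto_toeplitzDet` and the strong Szegő limit theorem
`Literature.Analysis.Toeplitz.strongSzego` (DIK Thm. 7, a named fact in Johansson–Widom generality).
Both inputs are now THEOREMS for the symbols that occur:

* `torusRowPair_tendsto_toeplitzDet_holds` (`OnsagerToeplitzProofs.lean`: transfer matrix, Kaufman's
  rotation, the Perron–Fock vacuum, Wick's theorem, Riemann sums);
* `Literature.Analysis.Toeplitz.strongSzego_geometric` (`StrongSzegoGeometric.lean`, proved: the strong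
  Szegő limit theorem for continuous `V` with `‖V_k‖ ≤ C r^{|k|}`, `r < 1`, via von Koch determinants and
  the Basor–Helton commutator), which covers Onsager's `V_β = log φ_β`
  (`norm_circleCoeff_onsagerLog_le`: `‖V_k‖ ≤ γ₂^{|k|}`, `γ₂ < 1` above `β_c`).

Hence (Deift–Its–Krasovsky 2013, §4: "SSLT applied to `φ_Onsager` for `T < T_c` gives
`lim D_n = M_0² = (1 - k²)^{1/4}`"):

* `tendsto_toeplitzDet_onsagerSymbol_holds` — **`D_n(φ_β) → m_O(β)²` for `β > β_c(2)`**, no hypothesis;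
* **`torusRowPairLimit_tendsto_onsagerYang_sq_holds`** — the DISCHARGE of the named fact
  `torusRowPairLimit_tendsto_onsagerYang_sq` (BGJS (3.4));
* `onsager_yang_of_wu`, `criticalBeta_two_of_wu` — `onsager_yang` (crit-ising.S16) and
  `criticalBeta_two` (crit-ising.S15) now rest on ONE named fact, Wu's 1966 decay
  `toeplitzDet_onsagerSymbol_exp_decay` of `D_k(φ_β)` for `β < β_c(2)` (used only for the
  subcritical half `m*(β) = 0`, `β < β_c`, and through it for the duality step (3.10)).

## References

* P. Deift, A. Its, I. Krasovsky, Comm. Pure Appl. Math. 66 (2013) 1360–1438, §§3–4.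
* G. Benettin, G. Gallavotti, G. Jona-Lasinio, A. L. Stella, Comm. Math. Phys. 30 (1973) 45–54, §3.
* E. W. Montroll, R. B. Potts, J. C. Ward, J. Math. Phys. 4 (1963) 308–322.
-/

noncomputable section

open Filter Literature.Analysis.Toeplitz
open scoped _root_.Topology

namespace Literature.Probability.LatticeModels

variable {β : ℝ}

/-- **Montroll–Potts–Ward via Szegő, unconditionally**: for `β > β_c(2)`, `D_n(φ_β) → m_O(β)²` as
`n → ∞` (Deift–Its–Krasovsky 2013, §4, eqs. (50)–(51) and the following display: SSLT for
`φ_Onsager` below `T_c` gives `M_0² = (1 - k²)^{1/4}`), by the strong Szegő limit theorem for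
geometrically decaying symbols (`strongSzego_geometric`) applied to `V_β = onsagerLog β`
(`‖V_k‖ ≤ γ₂^{|k|}`, `γ₂ < 1`). [cite: DeiftItsKrasovsky2013, §4, eqs. (50)–(51) and the following display] -/
theorem tendsto_toeplitzDet_onsagerSymbol_holds (hβ : criticalBetaTwo < β) :
    Tendsto (fun n : ℕ => toeplitzDet (circleCoeff (onsagerSymbol β)) n) atTop
      (𝓝 ((onsagerYangMagnetization β ^ 2 : ℝ) : ℂ)) := by
  have hβ0 : 0 < β := criticalBetaTwo_pos.trans hβ
  have hγ0 : 0 ≤ onsagerGammaTwo β := (onsagerGammaTwo_pos hβ0).le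
  have hγ1 : onsagerGammaTwo β < 1 := (onsagerGammaTwo_lt_one_iff hβ0).2 hβ
  have hcoef : ∀ k : ℤ, ‖circleCoeff (onsagerLog β) k‖ ≤ 1 * onsagerGammaTwo β ^ k.natAbs := fun k => by
    rw [one_mul]; exact norm_circleCoeff_onsagerLog_le onsagerLog_circleCoeff_holds hβ k
  have h := strongSzego_geometric (continuous_onsagerLog hβ) (onsagerLog_periodic β) hγ0 hγ1 hcoef
  have hexp : (fun θ => Complex.exp (onsagerLog β θ)) = onsagerSymbol β := funext (exp_onsagerLog hβ)
  have h0 : circleCoeff (onsagerLog β) 0 = 0 := (onsagerLog_circleCoeff_holds hβ).1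
  rw [hexp, (hasSum_szego_onsagerLog onsagerLog_circleCoeff_holds hβ).tsum_eq, ← Complex.ofReal_exp,
    exp_szego_onsager_eq_sq hβ] at h
  simp only [h0, mul_zero, Complex.exp_zero, div_one] at h
  exact h

/-- **BGJS (3.4) from the Toeplitz identity alone**: granting
`torusRowPair_tendsto_toeplitzDet` (the row two-point function of the cylinder state converges to
`D_k(φ_β)`, Montroll–Potts–Ward 1963 / Schultz–Mattis–Lieb 1964), the named fact
`torusRowPairLimit_tendsto_onsagerYang_sq` of `OnsagerYang.lean` holds — the strong Szegő limit
theorem is no longer a hypothesis. [cite: BenettinGallavottiJonaLasinioStella1973, §3 b), eq. (3.4)] -/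
theorem torusRowPairLimit_tendsto_onsagerYang_sq_of_toeplitzDet (hT : torusRowPair_tendsto_toeplitzDet) :
    torusRowPairLimit_tendsto_onsagerYang_sq := by
  intro β hβ
  have hβ0 : 0 < β := criticalBetaTwo_pos.trans hβ
  have h := (Complex.continuous_re.tendsto _).comp (tendsto_toeplitzDet_onsagerSymbol_holds hβ)
  have heq : ∀ k : ℕ, (toeplitzDet (circleCoeff (onsagerSymbol β)) k).re = torusRowPairLimit β k :=
    fun k => by rw [← torusRowPairLimit_eq_toeplitzDet hT hβ0 hβ.ne' k, Complex.ofReal_re]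
  simp only [Function.comp_def, Complex.ofReal_re] at h
  exact h.congr heq

/-- **BGJS (3.1)+(3.4) from the Toeplitz identity and Wu's decay** (Szegő discharged): the
long-range order of the plus state along a row. [cite: BenettinGallavottiJonaLasinioStella1973, §3, eq. (3.1) with eq. (3.4)] -/
theorem twoPointPlus_row_tendsto_onsagerYang_sq_of_toeplitzDet_wu (hT : torusRowPair_tendsto_toeplitzDet)
    (hWu : toeplitzDet_onsagerSymbol_exp_decay) : twoPointPlus_row_tendsto_onsagerYang_sq := by
  intro β hβ
  have hβ0 : 0 < β := criticalBetaTwo_pos.trans hβ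
  have hdual : ∀ x : Site 2, twoPointFree 2 β x = twoPointPlus 2 β x :=
    twoPointFree_eq_twoPointPlus_of_spontaneousMagnetization_dualBeta_eq_zero hβ0
      (spontaneousMagnetization_two_eq_zero_of_toeplitz hT hWu (dualBeta_pos hβ0).le
        (dualBeta_lt_criticalBetaTwo hβ))
  have heq : ∀ k : ℕ, torusRowPairLimit β k = twoPointPlus 2 β ![(k : ℤ), 0] := fun k => by
    obtain ⟨h1, h2⟩ := torusRowPairLimit_sandwich_at hβ0.le
      (tendsto_torusRowPair_outer_of_toeplitz hT hβ0 hβ.ne' k)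
    rw [hdual] at h1
    exact le_antisymm h2 h1
  exact (torusRowPairLimit_tendsto_onsagerYang_sq_of_toeplitzDet hT hβ).congr heq

/-- **Discharge of `torusRowPairLimit_tendsto_onsagerYang_sq` (BGJS eq. (3.4) = (1.3), the
Montroll–Potts–Ward long-range order)**: for `β > β_c(2)`, `(σ_{(0,0)}σ_{(k,0)})_p(β) → m_O(β)²`
as `k → ∞` — from the proved Toeplitz identity (`torusRowPair_tendsto_toeplitzDet_holds`) and the
proved strong Szegő limit theorem for geometric symbols (`strongSzego_geometric`)
(Benettin–Gallavotti–Jona-Lasinio–Stella 1973, §3 b), eq. (3.4): "(3.4) follows from the exact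
solution of the Ising model [3]"; Montroll–Potts–Ward 1963; Deift–Its–Krasovsky 2013, §4). [cite: BenettinGallavottiJonaLasinioStella1973, §3 b), eq. (3.4)] -/
theorem torusRowPairLimit_tendsto_onsagerYang_sq_holds : torusRowPairLimit_tendsto_onsagerYang_sq :=
  torusRowPairLimit_tendsto_onsagerYang_sq_of_toeplitzDet torusRowPair_tendsto_toeplitzDet_holds

/-- **`onsager_yang` (crit-ising.S16) from the Toeplitz identity and Wu's decay alone**: with the
strong Szegő limit theorem proved for geometric symbols, the Onsager–Yang formula rests on the
Montroll–Potts–Ward / Schultz–Mattis–Lieb identity `torusRowPair_tendsto_toeplitzDet` and Wu's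
decay `toeplitzDet_onsagerSymbol_exp_decay` only (Benettin–Gallavotti–Jona-Lasinio–Stella 1973,
§3; Deift–Its–Krasovsky 2013, §4). [cite: BenettinGallavottiJonaLasinioStella1973, §3 (main result)] -/
theorem onsager_yang_of_toeplitzDet_wu (hT : torusRowPair_tendsto_toeplitzDet)
    (hWu : toeplitzDet_onsagerSymbol_exp_decay) : onsager_yang :=
  have hgt : ∀ ⦃β : ℝ⦄, criticalBetaTwo < β →
      spontaneousMagnetization 2 β = onsagerYangMagnetization β :=
    fun _ hβ => spontaneousMagnetization_two_eq_onsagerYang_of_gt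
      (twoPointPlus_row_tendsto_onsagerYang_sq_of_toeplitzDet_wu hT hWu)
      twoPointPlus_tendsto_spontaneousMagnetization_sq_holds spontaneousMagnetization_nonneg_holds hβ
  onsager_yang_of_parts hgt (spontaneousMagnetization_two_eq_zero_of_toeplitz hT hWu)
    (spontaneousMagnetization_two_criticalBetaTwo_eq_zero_of hgt plusCorr_rightContinuous_holds)

/-- **`criticalBeta_two` (crit-ising.S15) from the Toeplitz identity and Wu's decay alone.** [cite: Lebowitz1972, §III (β_O = β_c)] -/
theorem criticalBeta_two_of_toeplitzDet_wu (hT : torusRowPair_tendsto_toeplitzDet)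
    (hWu : toeplitzDet_onsagerSymbol_exp_decay) : criticalBeta_two :=
  criticalBeta_two_of_onsager_yang (onsager_yang_of_toeplitzDet_wu hT hWu)

/-- **`onsager_yang` (crit-ising.S16) from Wu's decay alone**: the Onsager–Yang formula for the
spontaneous magnetisation of the square-lattice Ising model rests on ONE named fact, the exponential
decay of `D_k(φ_β)` for `0 < β < β_c(2)` (T. T. Wu, Phys. Rev. 149 (1966) 380; DIK §5 eq. (64)) —
everything else (GKS, transfer matrix, Kaufman–SML fermionic solution, the Toeplitz identity, the
strong Szegő limit theorem, Kramers–Wannier duality, Lebowitz–Martin-Löf, Messager–Miracle-Solé) is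
proved in the tree. [cite: BenettinGallavottiJonaLasinioStella1973, §3 (main result)] -/
theorem onsager_yang_of_wu (hWu : toeplitzDet_onsagerSymbol_exp_decay) : onsager_yang :=
  onsager_yang_of_toeplitzDet_wu torusRowPair_tendsto_toeplitzDet_holds hWu

/-- **`criticalBeta_two` (crit-ising.S15: `β_c(2) = ½ log (1 + √2)`) from Wu's decay alone.** [cite: Lebowitz1972, §III (β_O = β_c)] -/
theorem criticalBeta_two_of_wu (hWu : toeplitzDet_onsagerSymbol_exp_decay) : criticalBeta_two :=
  criticalBeta_two_of_onsager_yang (onsager_yang_of_wu hWu)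

end Literature.Probability.LatticeModels
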